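import Mathlib
import Summits.Parity.GeneralizedHardyLittlewood.Theorems.ParityLeakOneFifthPlainSplitCalibReductionDivisors
import Summits.Parity.GeneralizedHardyLittlewood.Theorems.ParityLeakOneFifthPlainSplitTwistedPerD
import Summits.Parity.GeneralizedHardyLittlewood.Theorems.ParityLeakOneFifthParityLeakSieveHostTypeI
import Summits.Parity.GeneralizedHardyLittlewood.Theorems.ParityLeakOneFifthParityLeakSieveModelTypeI
import Summits.Parity.GeneralizedHardyLittlewood.Theorems.ParityLeakOneFifthParityLeakSieveTypeIPer
import HarnessLib

/-!
# Route ParityLeakOneFifth, crux `ParityLeakSieve` (stmt-Parity-18381), skeleton `birth`: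
# the Type-I comparison of stub S1 — the bound for one modulus `d`

For a `y`-rough modulus `1 ≤ d ≤ D < y³`, with `2 < z ≤ w ≤ L`, `w ≤ y`, `6 ≤ y`:
`|S_a(d) − N_b(d)/V| ≤ (x/d)·(2C₁V_sh(w)E + 4/z + 6/y + C_b V_sh(z)Π E) + (R_a(d) + 1 + C_b V_sh(z)Π E + L²/V)`
(`E = e^{−log L/log w}`, `Π = ∏_{z≤p<w}(1 − 1/p)`, `R_a(d)` the sum of the host remainders at the moduli
`de`, `e ∣ P(w)`, `e ≤ L`): `host_FL_le`, `model_count_le`, and the main-term matching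
`typeI_per_d_arith`.
-/

namespace Summit.Parity.GeneralizedHardyLittlewood.Theorems.ParityLeakOneFifth

open Finset Real
open Literature.NumberTheory.Sieve

/-- **The Type-I bound for one modulus `d`** (constants `C₁` of `host_FL_le`, `C_b` of
`model_count_le`). -/
theorem typeI_per_d_bound : ∃ C₁ Cb : ℝ, 0 < C₁ ∧ 0 < Cb ∧
    ∀ (x d : ℕ) (z w L y D V Vshz Vshw P1 P2 : ℝ), 0 < d → (d : ℝ) ≤ D →
      (∀ p ∈ d.primeFactors, y ≤ (p : ℝ)) → 1 ≤ x → 2 < z → z ≤ w → w ≤ L → w ≤ y → 6 ≤ y → D < y ^ 3 →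
      V = ∏ p ∈ (Finset.range ⌈z⌉₊).filter Nat.Prime, (1 - 1 / (p : ℝ)) → 0 < V →
      Vshz = ∏ p ∈ (Finset.range ⌈z⌉₊).filter (fun p : ℕ => p.Prime ∧ p ≠ 2), (1 - 1 / ((p : ℝ) - 1)) →
      Vshw = ∏ p ∈ (Finset.range ⌈w⌉₊).filter (fun p : ℕ => p.Prime ∧ p ≠ 2), (1 - 1 / ((p : ℝ) - 1)) →
      P1 = ∏ p ∈ (Nat.primesBelow ⌈w⌉₊).filter (fun p : ℕ => z ≤ (p : ℝ)), (1 - 1 / (p : ℝ)) →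
      P2 = ∏ p ∈ (Nat.primesBelow ⌈w⌉₊).filter (fun p : ℕ => z ≤ (p : ℝ)), (1 - 1 / ((p : ℝ) - 1)) →
      |(∑ n ∈ (Finset.Ioc x (2 * x)).filter (fun n : ℕ => n.Prime ∧ d ∣ n + 2 ∧ w ≤ ((n + 2).minFac : ℝ)),
          Real.log (n : ℝ)) -
        (1 / V) * (#((Finset.Ioc x (2 * x)).filter (fun n : ℕ => (∀ p ∈ n.primeFactors, z ≤ (p : ℝ)) ∧
          w ≤ ((n + 2).minFac : ℝ) ∧ d ∣ n + 2)) : ℝ)| ≤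
      ((x : ℝ) / d) * (2 * C₁ * Vshw * Real.exp (-(Real.log L / Real.log w)) + 4 / z + 6 / y +
          Cb * (Vshz * P1) * Real.exp (-(Real.log L / Real.log w))) +
        ((∑ e ∈ (primesProdBelow w).divisors.filter (fun e : ℕ => (e : ℝ) ≤ L),
            |(∑ n ∈ (Finset.Ioc x (2 * x)).filter (fun n : ℕ => n.Prime ∧ d ∣ n + 2 ∧ e ∣ n + 2),
              Real.log (n : ℝ)) - shiftedPrimesDensity 2 e * ((x : ℝ) / (Nat.totient d : ℝ))|) +
          1 + Cb * (Vshz * P1) * Real.exp (-(Real.log L / Real.log w)) + L ^ 2 / V) := by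
  obtain ⟨C₁, hC₁, hFL⟩ := host_FL_le
  obtain ⟨Cb, hCb, hNB⟩ := model_count_le
  refine ⟨C₁, Cb, hC₁, hCb, ?_⟩
  intro x d z w L y D V Vshz Vshw P1 P2 hd0 hdD hdr hx1 hz2 hzw hwL hwy hy6 hDy3 hV hV0 hVshz hVshw hP1 hP2
  have hdR : (0 : ℝ) < d := by exact_mod_cast hd0
  have hx0 : (0 : ℝ) ≤ x := Nat.cast_nonneg x
  have hy0 : 0 < y := by linarith
  have hy1 : 1 ≤ y := by linarith
  have hw2 : 2 ≤ w := by linarith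
  have hdw : ∀ p : ℕ, p.Prime → (p : ℝ) < w → ¬ p ∣ d := by
    intro p hp hpw hpd
    have := hdr p (Nat.mem_primeFactors.2 ⟨hp, hpd, hd0.ne'⟩)
    linarith
  have hFLa := hFL x d w L hd0 hw2 hwL hdw
  rw [← hVshw] at hFLa
  have hFLb := hNB x d z w L hd0 hx1 hz2 hzw hwL hdw
  rw [← hV, ← hVshz, ← hP1] at hFLb
  rw [show V * Vshz * P1 = V * (Vshz * P1) by ring] at hFLb
  -- products
  have hVshz0 : 0 ≤ Vshz := by
    rw [hVshz]
    refine Finset.prod_nonneg fun p hp => ?_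
    obtain ⟨-, hpr, hne⟩ := Finset.mem_filter.1 hp
    have h3 : (3 : ℝ) ≤ p := by exact_mod_cast (by have := hpr.two_le; omega : 3 ≤ p)
    rw [sub_nonneg, div_le_one (by linarith)]; linarith
  have hVshz1 : Vshz ≤ 1 := by
    rw [hVshz]
    refine Finset.prod_le_one (fun p hp => ?_) (fun p hp => ?_)
    · obtain ⟨-, hpr, hne⟩ := Finset.mem_filter.1 hp
      have h3 : (3 : ℝ) ≤ p := by exact_mod_cast (by have := hpr.two_le; omega : 3 ≤ p)
      rw [sub_nonneg, div_le_one (by linarith)]; linarith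
    · obtain ⟨-, hpr, hne⟩ := Finset.mem_filter.1 hp
      have h3 : (3 : ℝ) ≤ p := by exact_mod_cast (by have := hpr.two_le; omega : 3 ≤ p)
      have : (0 : ℝ) ≤ 1 / ((p : ℝ) - 1) := by apply div_nonneg zero_le_one; linarith
      linarith
  have hP1mem : ∀ p ∈ (Nat.primesBelow ⌈w⌉₊).filter (fun p : ℕ => z ≤ (p : ℝ)), (2 : ℝ) < p := by
    intro p hp; rw [Finset.mem_filter] at hp; linarith [hp.2]
  have hP10 : 0 ≤ P1 := by
    rw [hP1]; refine Finset.prod_nonneg fun p hp => ?_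
    have := hP1mem p hp
    rw [sub_nonneg, div_le_one (by linarith)]; linarith
  have hP11 : P1 ≤ 1 := by
    rw [hP1]; refine Finset.prod_le_one (fun p hp => ?_) (fun p hp => ?_)
    · have := hP1mem p hp
      rw [sub_nonneg, div_le_one (by linarith)]; linarith
    · have : (0 : ℝ) ≤ 1 / (p : ℝ) := by positivity
      linarith
  have hP20 : 0 ≤ P2 := by
    rw [hP2]; refine Finset.prod_nonneg fun p hp => ?_
    have := hP1mem p hp
    rw [sub_nonneg, div_le_one (by linarith)]; linarith
  have hP21 : |P2 - P1| ≤ 2 / z := by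
    rw [hP2, hP1]
    refine (abs_prod_sub_prod_le hz2.le).trans ?_
    rw [div_le_div_iff₀ (by linarith) (by linarith)]; linarith
  have hVshw_split : Vshw = Vshz * P2 := by rw [hVshw, hVshz, hP2]; exact Vsh_split hz2 hzw
  -- `1/φ(d)` versus `1/d`
  have hk : #d.primeFactors ≤ 2 := by
    have hΩ := cardFactors_le_two_of_le hy1 hDy3 hd0.ne' hdr hdD
    have hω : #d.primeFactors ≤ ArithmeticFunction.cardFactors d := by
      rw [Nat.primeFactors, ArithmeticFunction.cardFactors_apply]; exact List.toFinset_card_le _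
    exact hω.trans hΩ
  obtain ⟨hφ1, -⟩ := inv_totient_sub_inv_le hd0.ne' (by linarith : (2 : ℝ) ≤ y) hdr hk
  have hφ0 : 0 ≤ 1 / (Nat.totient d : ℝ) - 1 / (d : ℝ) := by
    have h1 : (Nat.totient d : ℝ) ≤ d := by exact_mod_cast Nat.totient_le d
    have h2 : (0 : ℝ) < Nat.totient d := by exact_mod_cast Nat.totient_pos.2 hd0
    rw [sub_nonneg]; exact one_div_le_one_div_of_le h2 h1
  have exd : (x : ℝ) * (1 / (Nat.totient d : ℝ) - 1 / (d : ℝ)) = (x : ℝ) / (Nat.totient d : ℝ) - (x : ℝ) / d := by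
    ring
  have hxφ0 : 0 ≤ (x : ℝ) / (Nat.totient d : ℝ) - (x : ℝ) / d := by
    have := mul_nonneg hx0 hφ0; linarith
  have hxφ1 : (x : ℝ) / (Nat.totient d : ℝ) - (x : ℝ) / d ≤ 6 * ((x : ℝ) / d) / y := by
    have h1 := mul_le_mul_of_nonneg_left hφ1 hx0
    rw [exd] at h1
    refine h1.trans ?_
    have h36 : 3 / (y - 1) ≤ 6 / y := by
      rw [div_le_div_iff₀ (by linarith) hy0]; linarith
    calc (x : ℝ) * (3 / ((y - 1) * d)) = ((x : ℝ) / d) * (3 / (y - 1)) := by field_simp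
      _ ≤ ((x : ℝ) / d) * (6 / y) := mul_le_mul_of_nonneg_left h36 (by positivity)
      _ = 6 * ((x : ℝ) / d) / y := by ring
  have hxφ2 : (x : ℝ) / (Nat.totient d : ℝ) ≤ 2 * ((x : ℝ) / d) := by
    have : 6 * ((x : ℝ) / d) / y ≤ (x : ℝ) / d := by
      rw [div_le_iff₀ hy0]
      have : 0 ≤ (x : ℝ) / d := by positivity
      nlinarith
    linarith
  -- `J`
  have hK : (x + 2) / d ≤ (2 * x + 2) / d := Nat.div_le_div_right (by omega)
  have hJ : |(((2 * x + 2) / d - (x + 2) / d : ℕ) : ℝ) - (x : ℝ) / d| ≤ 1 := by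
    rw [abs_le]
    constructor
    · rw [Nat.cast_sub hK]
      have h1 : ((2 * (x : ℝ) + 2)) / d - 1 ≤ (((2 * x + 2) / d : ℕ) : ℝ) := by
        have := Nat.lt_div_mul_add (a := 2 * x + 2) hd0
        have h' : (2 * (x : ℝ) + 2) < ((((2 * x + 2) / d : ℕ) : ℝ)) * d + d := by exact_mod_cast this
        rw [div_sub_one hdR.ne', div_le_iff₀ hdR]; linarith
      have h2 : (((x + 2) / d : ℕ) : ℝ) ≤ ((x : ℝ) + 2) / d := by
        have := Nat.cast_div_le (m := x + 2) (n := d) (α := ℝ); push_cast at this; exact this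
      have e : (2 * (x : ℝ) + 2) / d - ((x : ℝ) + 2) / d = (x : ℝ) / d := by field_simp; ring
      linarith
    · have := natCast_div_sub_div_le (A := 2 * x + 2) (B := x + 2) (q := d) (by omega) hd0
      push_cast at this
      have e : (2 * (x : ℝ) + 2 - ((x : ℝ) + 2)) / d = (x : ℝ) / d := by ring
      linarith
  have hxd0 : 0 ≤ (x : ℝ) / d := by positivity
  have h := typeI_per_d_arith hFLa hFLb hVshw_split rfl hP21 hP10 hP11 hP20 hVshz0 hVshz1
    hxφ0 hxφ1 hxφ2 hJ hV0 hxd0 hC₁.le hCb.le (Real.exp_pos _).le (by linarith) hy0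
  rw [show (1 / V) * (#((Finset.Ioc x (2 * x)).filter (fun n : ℕ => (∀ p ∈ n.primeFactors, z ≤ (p : ℝ)) ∧
      w ≤ ((n + 2).minFac : ℝ) ∧ d ∣ n + 2)) : ℝ) =
    (#((Finset.Ioc x (2 * x)).filter (fun n : ℕ => (∀ p ∈ n.primeFactors, z ≤ (p : ℝ)) ∧
      w ≤ ((n + 2).minFac : ℝ) ∧ d ∣ n + 2)) : ℝ) / V by ring]
  refine h.trans (le_of_eq ?_)
  ring

end Summit.Parity.GeneralizedHardyLittlewood.Theorems.ParityLeakOneFifth
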